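import Mathlib
import Summits.ValiantsHypothesis.ValiantsHypothesis.Theorems.BarrierLeverDefinableEquationsProductDepthWallTwoWords
import Summits.ValiantsHypothesis.ValiantsHypothesis.Theorems.BarrierLeverDefinableEquationsBlockPlacement

/-!
# Route BarrierLever — crux `DefinableEquations` (stmt-8745) / item `SingleSizeEquations`
# (stmt-8749): the LST block rank is invariant under REINDEXING THE BLOCKS of a word
# (val-np-p5 g15, part 5 of `…ProductDepthWallTwo*`)

§8 Two sign patterns on `d` blocks with the same number of positive blocks differ by a
permutation `π` of the blocks (`exists_perm_of_card_eq`, via `Equiv.sumCompl`).  The block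
variables of the reindexed word `pos ∘ π` are block variables of `pos` (`reix`, same letter sizes),
an embedding `e` of the latter into `x_1, …, x_n` induces one of the former (`reixEmb`), and for
every `f ∈ ℂ[x_1..x_n]` the block coefficient matrix for the datum `(pos ∘ π, e ∘ reix)` is a
row/column PERMUTATION (`pullAssign`, a bijection by counting) of the one for `(pos, e)`
(`mapDomain_reix_assignMonomial`); hence `pdRank (killCompl e f)` is the same for both data
(`pdRank_killCompl_reindex`, through the tree's `BlockPlacement.pdRank_killCompl_eq_rank` and
`Matrix.rank_submatrix`).  The end stream lengths agree too (`streamLen_reindex`).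

The three `def`s (`reix`, `pullAssign`, `reixEmb`) are the explicit reindexing maps.
What this is NOT: nothing on the crux (b = 2 OPEN, Chatterjee–Tengse §1.3 dir. 2) or `VP ≠ VNP`;
no named facts, standard axioms.
Refs: Limaye–Srinivasan–Tavenas, J. ACM 72 (2025) Art. 26, §2.1–2.2.
-/

-- `Summit.ValiantsHypothesis.ValiantsHypothesis.…` repeats a component (D-0017 layout); mandated.
set_option linter.dupNamespace false

noncomputable section

namespace Summit.ValiantsHypothesis.ValiantsHypothesis.Theorems.BarrierLeverDefinableEquations

open MvPolynomial
open Literature.Computability.AlgebraicComplexity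
open Literature.Computability.AlgebraicComplexity.LSTWord
open Literature.Barriers.ValiantsHypothesis
open scoped BigOperators

namespace ProductDepthWallTwo

/-! ## §8 Reindexing the blocks of a word by a sign-preserving permutation -/

section Reindex

variable {d : ℕ} (k : ℕ) (pos : Fin d → Bool)

/-- Two words with the same number of positive blocks differ by a permutation of the blocks.
[folklore] -/
theorem exists_perm_of_card_eq (w : Fin d → Bool)
    (h : (Finset.univ.filter fun t : Fin d => w t = true).card =
      (Finset.univ.filter fun i : Fin d => pos i = true).card) :
    ∃ π : Fin d ≃ Fin d, ∀ t, pos (π t) = w t := by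
  classical
  have h1 : Fintype.card {t : Fin d // w t = true} = Fintype.card {i : Fin d // pos i = true} := by
    rw [Fintype.card_subtype, Fintype.card_subtype, h]
  have h0 : Fintype.card {t : Fin d // ¬ (w t = true)} =
      Fintype.card {i : Fin d // ¬ (pos i = true)} := by
    rw [Fintype.card_subtype_compl, Fintype.card_subtype_compl, h1]
  obtain ⟨e₁⟩ := Fintype.truncEquivOfCardEq h1 |>.nonempty
  obtain ⟨e₀⟩ := Fintype.truncEquivOfCardEq h0 |>.nonempty
  refine ⟨(Equiv.sumCompl fun t : Fin d => w t = true).symm.trans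
    ((e₁.sumCongr e₀).trans (Equiv.sumCompl fun i : Fin d => pos i = true)), fun t => ?_⟩
  by_cases ht : w t = true
  · simp only [Equiv.trans_apply, Equiv.sumCompl_symm_apply_of_pos (p := fun t => w t = true) ht,
      Equiv.sumCongr_apply, Sum.map_inl, Equiv.sumCompl_apply_inl, ht]
    exact (e₁ ⟨t, ht⟩).2
  · simp only [Equiv.trans_apply, Equiv.sumCompl_symm_apply_of_neg (p := fun t => w t = true) ht,
      Equiv.sumCongr_apply, Sum.map_inr, Equiv.sumCompl_apply_inr]
    rw [Bool.not_eq_true] at ht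
    rw [ht]
    exact Bool.eq_false_iff.2 (e₀ ⟨t, by rw [ht]; decide⟩).2

variable (π : Fin d ≃ Fin d)

/-- The block variables of the reindexed word `pos ∘ π` ARE block variables of `pos`
(block `t` of `pos ∘ π` is block `π t` of `pos`, with the same letter size). [folklore] -/
def reix (v : Σ t : Fin d, BlockVar k (fun t => pos (π t)) t) : Σ i : Fin d, BlockVar k pos i :=
  ⟨π v.1, v.2⟩

/-- The reindexing of block variables is injective. [folklore] -/
theorem reix_injective : Function.Injective (reix k pos π) := by
  rintro ⟨t, x⟩ ⟨t', x'⟩ h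
  simp only [reix, Sigma.mk.inj_iff, EmbeddingLike.apply_eq_iff_eq] at h
  obtain ⟨rfl, h2⟩ := h
  simp at h2
  subst h2; rfl

/-- The reindexed word has the same number of positive blocks. [folklore] -/
theorem card_pos_reindex :
    (Finset.univ.filter fun t : Fin d => pos (π t) = true).card =
      (Finset.univ.filter fun i : Fin d => pos i = true).card := by
  rw [← Fintype.card_subtype, ← Fintype.card_subtype]
  exact Fintype.card_congr (Equiv.subtypeEquiv π fun t => Iff.rfl)

/-- Hence the same stream lengths at the end. [cite: LimayeSrinivasanTavenas2025, §2.2] -/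
theorem streamLen_reindex (sgn : Bool) :
    streamLen k (fun t => pos (π t)) sgn d = streamLen k pos sgn d := by
  cases sgn
  · rw [streamLen_false_top, streamLen_false_top, card_pos_reindex]
  · rw [streamLen_true_top, streamLen_true_top, card_pos_reindex]

variable {A A' : Finset (Fin d)} (hA : ∀ t : Fin d, t ∈ A' ↔ π t ∈ A)

/-- Pulling an assignment on the blocks `A` of `pos` back to the blocks `A' = π⁻¹ A` of
`pos ∘ π`. [folklore] -/
def pullAssign (r : Assignment (BlockVar k pos) A) :
    Assignment (BlockVar k (fun t => pos (π t))) A' :=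
  fun t => r ⟨π t.1, (hA t.1).1 t.2⟩

/-- The pull-back of assignments is injective. [folklore] -/
theorem pullAssign_injective : Function.Injective (pullAssign k pos π hA) := by
  intro r₁ r₂ h
  funext j
  obtain ⟨j, hj⟩ := j
  obtain ⟨t, rfl⟩ := π.surjective j
  exact congrFun h ⟨t, (hA t).2 hj⟩

include hA in
/-- The two assignment types have the same size. [folklore] -/
theorem card_assignment_reindex :
    Fintype.card (Assignment (BlockVar k pos) A) =
      Fintype.card (Assignment (BlockVar k (fun t => pos (π t))) A') := by
  classical
  calc Fintype.card (Assignment (BlockVar k pos) A) = ∏ i ∈ A, Fintype.card (BlockVar k pos i) := by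
        convert card_assignment (X := BlockVar k pos) A
    _ = ∏ t ∈ A', Fintype.card (BlockVar k (fun t => pos (π t)) t) := by
        rw [← Finset.prod_coe_sort A, ← Finset.prod_coe_sort A']
        exact (Fintype.prod_equiv (Equiv.subtypeEquiv π hA) _ _ fun t => rfl).symm
    _ = _ := by convert (card_assignment (X := BlockVar k (fun t => pos (π t))) A').symm

/-- The pull-back of assignments is bijective. [folklore] -/
theorem pullAssign_bijective : Function.Bijective (pullAssign k pos π hA) := by
  classical
  rw [Fintype.bijective_iff_injective_and_card]
  exact ⟨pullAssign_injective k pos π hA, card_assignment_reindex k pos π hA⟩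

/-- The assignment monomial of a pulled-back assignment, pushed forward along the reindexing,
is the original assignment monomial. [folklore] -/
theorem mapDomain_reix_assignMonomial (r : Assignment (BlockVar k pos) A) :
    Finsupp.mapDomain (reix k pos π) (assignMonomial A' (pullAssign k pos π hA r)) =
      assignMonomial A r := by
  classical
  unfold assignMonomial
  rw [Finsupp.mapDomain_finsetSum]
  simp only [Finsupp.mapDomain_single]
  rw [Finset.attach_eq_univ, Finset.attach_eq_univ]
  exact Fintype.sum_equiv (Equiv.subtypeEquiv π hA) _ _ fun t => rfl

variable {n : ℕ} (e : (Σ i : Fin d, BlockVar k pos i) ↪ Fin n)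

/-- The embedding of the reindexed block variables into `x_1, …, x_n`. [folklore] -/
def reixEmb : (Σ t : Fin d, BlockVar k (fun t => pos (π t)) t) ↪ Fin n :=
  ⟨fun v => e (reix k pos π v), e.injective.comp (reix_injective k pos π)⟩

/-- Membership in the positive blocks of `pos ∘ π` versus `pos`. [folklore] -/
theorem mem_posBlocks_reindex (t : Fin d) :
    t ∈ posBlocks (fun t => pos (π t)) ↔ π t ∈ posBlocks pos := by simp

/-- Membership in the negative blocks of `pos ∘ π` versus `pos`. [folklore] -/
theorem mem_negBlocks_reindex (t : Fin d) :
    t ∈ negBlocks (fun t => pos (π t)) ↔ π t ∈ negBlocks pos := by simp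

/-- **Block rank is invariant under reindexing the blocks**: the coefficient matrix of `f` for the
datum `(pos ∘ π, e ∘ reix)` is a row/column permutation of the one for `(pos, e)`.
[cite: LimayeSrinivasanTavenas2025, §2.1] -/
theorem pdRank_killCompl_reindex (f : MvPolynomial (Fin n) ℂ) :
    pdRank ℂ (posBlocks pos) (negBlocks pos) (killCompl e.injective f) =
      pdRank ℂ (posBlocks fun t => pos (π t)) (negBlocks fun t => pos (π t))
        (killCompl (reixEmb k pos π e).injective f) := by
  classical
  rw [BlockPlacement.pdRank_killCompl_eq_rank, BlockPlacement.pdRank_killCompl_eq_rank]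
  set M := Matrix.of fun (rr : Assignment (BlockVar k (fun t => pos (π t))) (posBlocks fun t => pos (π t)))
      (cc : Assignment (BlockVar k (fun t => pos (π t))) (negBlocks fun t => pos (π t))) =>
    coeff (Finsupp.mapDomain (reixEmb k pos π e) (assignMonomial _ rr + assignMonomial _ cc)) f with hM
  set eR := Equiv.ofBijective _ (pullAssign_bijective k pos π (mem_posBlocks_reindex pos π)) with heR
  set eC := Equiv.ofBijective _ (pullAssign_bijective k pos π (mem_negBlocks_reindex pos π)) with heC
  have key : ∀ (rr : Assignment (BlockVar k pos) (posBlocks pos))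
      (cc : Assignment (BlockVar k pos) (negBlocks pos)),
      Finsupp.mapDomain (reixEmb k pos π e)
          (assignMonomial _ (pullAssign k pos π (mem_posBlocks_reindex pos π) rr) +
            assignMonomial _ (pullAssign k pos π (mem_negBlocks_reindex pos π) cc)) =
        Finsupp.mapDomain e (assignMonomial _ rr + assignMonomial _ cc) := by
    intro rr cc
    change Finsupp.mapDomain (e ∘ reix k pos π) _ = _
    rw [Finsupp.mapDomain_comp, Finsupp.mapDomain_add, mapDomain_reix_assignMonomial,
      mapDomain_reix_assignMonomial, Finsupp.mapDomain_add]
  have hsub : (Matrix.of fun (rr : Assignment (BlockVar k pos) (posBlocks pos))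
      (cc : Assignment (BlockVar k pos) (negBlocks pos)) =>
        coeff (Finsupp.mapDomain e (assignMonomial _ rr + assignMonomial _ cc)) f) =
      M.submatrix eR eC := by
    ext rr cc
    simp only [Matrix.submatrix_apply, hM, Matrix.of_apply, heR, heC, Equiv.ofBijective_apply]
    rw [key]
  rw [hsub, Matrix.rank_submatrix]

end Reindex

end ProductDepthWallTwo

end Summit.ValiantsHypothesis.ValiantsHypothesis.Theorems.BarrierLeverDefinableEquations
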